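import Mathlib
import Summits.Ventures.PercRepro2.CoinTreeCore
import Summits.Ventures.PercRepro2.CoinOrTailKDefs
import Summits.Ventures.PercRepro2.CoinKSureMarkerBExample
import Summits.Ventures.PercRepro2.CoinKSureMarkerABCoins

/-!
# Both markers at OR-vertices on the 14-coin instance (blind cell PercRepro2, night-2 g15;
NIGHT2-DARC.md §55)

The 14-coin system of `CoinKSureMarkerBExample` on `Fin 10`: row 2′DARC at `a → w` for the
markers `(a, b)` — the tail of the free arc and the second OR-vertex of the head — for EVERY
probability vector, no hypothesis (`darc_markerAB_example_coins`), and the mirror `(b, a)`.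
-/

namespace Summit.Ventures.PercRepro2.Coin

namespace MarkerBExample

open Classical

/-- **Row 2′DARC at `a → w` for the markers `(a, b)` on the 14-coin instance, every probability
vector — no hypothesis.** -/
theorem darc_markerAB_example_coins {R : Type*} [Field R] [LinearOrder R] [IsStrictOrderedRing R]
    (pr : Fin 14 → R) (hp : IsProbVec pr) :
    DARC pr arcsMB 0 {9} 6 7 6 8 :=
  darc_of_orTailTreeK_markerAB_coins pr hp sameEnds_mb orTailK_mb orTailKb_mb (by decide)
    treeCore_mb (by decide) (by decide) (by decide) (by decide)

/-- **Row 2′DARC at `a → w` for the markers `(b, a)` on the 14-coin instance, every probability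
vector — no hypothesis.** -/
theorem darc_markerAB_example_coins' {R : Type*} [Field R] [LinearOrder R] [IsStrictOrderedRing R]
    (pr : Fin 14 → R) (hp : IsProbVec pr) :
    DARC pr arcsMB 0 {9} 7 6 6 8 :=
  darc_of_orTailK_markerAB_coins' pr hp sameEnds_mb orTailK_mb orTailKb_mb (by decide)
    (treeCore_mb.coreLevel_lsm pr hp) (by decide) (by decide) (by decide) (by decide)

end MarkerBExample

end Summit.Ventures.PercRepro2.Coin
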